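import Mathlib.Algebra.Polynomial.Degree.SmallDegree
import Literature.NumberTheory.EllipticCurves.BSDRootNumber
import Literature.NumberTheory.DiophantineGeometry.LocalReductionProofs
import Literature.NumberTheory.DiophantineGeometry.LocalReductionHasMultiplicativeReductionAtProofs
import Literature.NumberTheory.DiophantineGeometry.LocalReductionFiniteBadPlacesProofs
import Literature.NumberTheory.DiophantineGeometry.LocalReductionIsIntegralAtProofs
import Literature.NumberTheory.DiophantineGeometry.LocalReductionIsSemistableAtProofs
import Literature.RingTheory.DiscreteValuationRing.AdicCompletionResidueField
import Literature.NumberTheory.EllipticCurves.RootNumberAtkinLehnerSemistableProofs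
import Literature.NumberTheory.EllipticCurves.SzpiroLocalDataProofs
import Literature.NumberTheory.DiophantineGeometry.PastenValuationProductsProofs
import Summits.BirchSwinnertonDyer.Rank2.ToyRankThreeOrderEqualityAtTwo
import HarnessLib

/-!
# The toy curve `E₀ : y² + xy = x³ + 4x² + 105x` (conductor `675255 = 3·5·7·59·109`): local root
# numbers, the algebraic root number `−1`, semistability

Cell `bsd-rank2`, seat `bsd-rank2-eng-2` GEN 4; companion of `Rank2/ToyRankThreeOrderEqualityAtTwo.lean`
(the BC5 toy of route-sketch `TwoAdicLambdaTransport`, planner p2 G14 memo `PADIC-R2-G14.md` §4.4;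
director-bsd 2026-08-27T04:43:36Z (5)). PURPOSE: discharge clause (ii) of the toy's analytic certificate
(`T + 2 ∣ g`) — which by lit GEN 15's `X_add_C_two_dvd_of_analyticRank_quadraticTwist_two_ne_zero` needs
only `ord_{s=1} L(E₀^{(2)}, s) ≠ 0`, i.e. the SIGN `w(E₀^{(2)}) = −1` — from the tree's root-number
theory. This file is the local half, on the template of the tree's `Curve5077aRootNumber`:

* `toy_Δ`, `toy_c₄` (`Δ = −70901775 = −3²·5²·7²·59·109`, `c₄ = −4751`, a prime), `toy_isIntegralAt`;
* at a finite place `v` of `ℤ` with `v(Δ) < 1` the prime below `v` is one of `3, 5, 7, 59, 109`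
  (`toy_natGenerator_mem`), `c₄` is a `v`-unit (`toy_valuation_c₄_eq_one`), so the reduction is
  MULTIPLICATIVE (`toy_hasMultiplicativeReductionAt`); Mathlib's node-tangent quadratic
  `c₄ T² + a₁c₄ T − (54 b₆ − 3 b₂ b₄ + a₂ c₄) = −4751 T² − 4751 T + 29714` has NO root modulo `3, 5, 7`
  (kernel-decided over `ZMod p`) and the roots `13 (mod 59)`, `20 (mod 109)`: NON-SPLIT at `3, 5, 7`
  (`toy_not_split`), SPLIT at `59, 109` (`toy_split`);
* `toy_localRootNumberAt_of_…` — `w_v = +1` at good and non-split places, `−1` at the places above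
  `59` and `109` (Rohrlich 1993 Prop. 2, tree bsd.S35/S36);
* `toy_isSemistable`, `toy_squarefree_conductorNorm`.

The global assembly (`−∏ w_v = −1`, the conductor `675255`, `w(E₀) = w(E₀^{(2)}) = −1` under modularity,
and the upgraded toy theorem) is the companion `Rank2/ToyRankThreeRootNumber.lean`.

THEOREMS ONLY (no definition, no named fact, no `sorry`). PARTITION: none — r_an ≥ 2, summit axis S0;
TWIN (D-0056): n/a. B1 honesty: local reduction data of ONE explicit curve; no S0 motion.

References: D. Rohrlich, *Compositio Math.* 87 (1993) Prop. 2 [Rohrlich1993Compositio]; J. H. Silverman,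
*AEC* (2009) VII.1 Rem. 1.1, VII.5 Prop. 5.1 [SilvermanAEC2009].
-/

set_option linter.dupNamespace false

noncomputable section

open IsDedekindDomain IsDedekindDomain.HeightOneSpectrum WeierstrassCurve Polynomial
  Rat.HeightOneSpectrum Literature.NumberTheory.EllipticCurves

namespace Summit.BirchSwinnertonDyer.Rank2

/-! ### §1 Invariants and integrality -/

/-- `Δ(E₀) = −70901775`. [cite: SilvermanAEC2009, III §1] -/
theorem toy_Δ : (⟨1, 4, 0, 105, 0⟩ : WeierstrassCurve ℚ).Δ = -70901775 := by
  norm_num [WeierstrassCurve.Δ, WeierstrassCurve.b₂, WeierstrassCurve.b₄, WeierstrassCurve.b₆,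
    WeierstrassCurve.b₈]

/-- `c₄(E₀) = −4751`. [cite: SilvermanAEC2009, III §1] -/
theorem toy_c₄ : (⟨1, 4, 0, 105, 0⟩ : WeierstrassCurve ℚ).c₄ = -4751 := by
  norm_num [WeierstrassCurve.c₄, WeierstrassCurve.b₂, WeierstrassCurve.b₄]

/-- `b₂(E₀) = 17`. [cite: SilvermanAEC2009, III §1] -/
theorem toy_b₂ : (⟨1, 4, 0, 105, 0⟩ : WeierstrassCurve ℚ).b₂ = 17 := by
  norm_num [WeierstrassCurve.b₂]

/-- `b₄(E₀) = 210`. [cite: SilvermanAEC2009, III §1] -/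
theorem toy_b₄ : (⟨1, 4, 0, 105, 0⟩ : WeierstrassCurve ℚ).b₄ = 210 := by
  norm_num [WeierstrassCurve.b₄]

/-- `b₆(E₀) = 0`. [cite: SilvermanAEC2009, III §1] -/
theorem toy_b₆ : (⟨1, 4, 0, 105, 0⟩ : WeierstrassCurve ℚ).b₆ = 0 := by
  norm_num [WeierstrassCurve.b₆]

/-- `E₀` is integral at every finite place of `ℤ`. [cite: SilvermanAEC2009, VIII.8] -/
theorem toy_isIntegralAt (v : HeightOneSpectrum ℤ) :
    (⟨1, 4, 0, 105, 0⟩ : WeierstrassCurve ℚ).IsIntegralAt v := by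
  rw [isIntegralAt_iff_valuation_le_one]
  refine ⟨by simp, ?_, by simp, ?_, by simp⟩
  · have h := v.valuation_le_one (K := ℚ) (4 : ℤ)
    change v.valuation ℚ ((algebraMap ℤ ℚ) (4 : ℤ)) ≤ 1 at h
    have e : (algebraMap ℤ ℚ) (4 : ℤ) = (4 : ℚ) := by rw [map_ofNat]
    rw [e] at h
    simpa using h
  · have h := v.valuation_le_one (K := ℚ) (105 : ℤ)
    change v.valuation ℚ ((algebraMap ℤ ℚ) (105 : ℤ)) ≤ 1 at h
    have e : (algebraMap ℤ ℚ) (105 : ℤ) = (105 : ℚ) := by rw [map_ofNat]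
    rw [e] at h
    simpa using h

/-! ### §2 The bad places: `v(Δ) < 1` iff the prime below `v` is one of `3, 5, 7, 59, 109` -/

/-- A prime dividing `70901775 = 3²·5²·7²·59·109` is one of `3, 5, 7, 59, 109`. [folklore] -/
theorem prime_dvd_toyΔ {p : ℕ} (hp : p.Prime) (h : p ∣ 70901775) :
    p = 3 ∨ p = 5 ∨ p = 7 ∨ p = 59 ∨ p = 109 := by
  have h3 : Nat.Prime 3 := by norm_num
  have h5 : Nat.Prime 5 := by norm_num
  have h7 : Nat.Prime 7 := by norm_num
  have h59 : Nat.Prime 59 := by norm_num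
  have h109 : Nat.Prime 109 := by norm_num
  have e : (70901775 : ℕ) = 3 * (3 * (5 * (5 * (7 * (7 * (59 * 109)))))) := by norm_num
  rw [e] at h
  simp only [hp.dvd_mul] at h
  rcases h with h | h | h | h | h | h | h | h
  · exact Or.inl ((Nat.prime_dvd_prime_iff_eq hp h3).mp h)
  · exact Or.inl ((Nat.prime_dvd_prime_iff_eq hp h3).mp h)
  · exact Or.inr (Or.inl ((Nat.prime_dvd_prime_iff_eq hp h5).mp h))
  · exact Or.inr (Or.inl ((Nat.prime_dvd_prime_iff_eq hp h5).mp h))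
  · exact Or.inr (Or.inr (Or.inl ((Nat.prime_dvd_prime_iff_eq hp h7).mp h)))
  · exact Or.inr (Or.inr (Or.inl ((Nat.prime_dvd_prime_iff_eq hp h7).mp h)))
  · exact Or.inr (Or.inr (Or.inr (Or.inl ((Nat.prime_dvd_prime_iff_eq hp h59).mp h))))
  · exact Or.inr (Or.inr (Or.inr (Or.inr ((Nat.prime_dvd_prime_iff_eq hp h109).mp h))))

/-- At a place `v` with `v(Δ(E₀)) < 1` the prime below `v` is `3, 5, 7, 59` or `109`. [folklore] -/
theorem toy_natGenerator_mem {v : HeightOneSpectrum ℤ}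
    (h : v.valuation ℚ (⟨1, 4, 0, 105, 0⟩ : WeierstrassCurve ℚ).Δ < 1) :
    natGenerator v = 3 ∨ natGenerator v = 5 ∨ natGenerator v = 7 ∨ natGenerator v = 59 ∨
      natGenerator v = 109 := by
  rw [toy_Δ, show (-70901775 : ℚ) = ((-70901775 : ℤ) : ℚ) by norm_num,
    Literature.NumberTheory.EllipticCurves.Rat.valuation_intCast_lt_one_iff] at h
  have h' : natGenerator v ∣ 70901775 := by
    have : (natGenerator v : ℤ) ∣ (70901775 : ℕ) := (Int.dvd_neg.mpr h : _)
    exact_mod_cast this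
  exact prime_dvd_toyΔ (prime_natGenerator v) h'

/-- The prime below `v` lies in `v`. [folklore] -/
theorem natGenerator_mem_asIdeal (v : HeightOneSpectrum ℤ) : (natGenerator v : ℤ) ∈ v.asIdeal := by
  have h : v.valuation ℚ (((natGenerator v : ℤ) : ℤ) : ℚ) < 1 :=
    (Literature.NumberTheory.EllipticCurves.Rat.valuation_intCast_lt_one_iff v _).mpr dvd_rfl
  exact (v.valuation_lt_one_iff_mem (natGenerator v : ℤ)).mp (by simpa using h)

/-- An integer divisible by the prime below `v` lies in `v`. [folklore] -/
theorem intCast_mem_asIdeal_of_dvd (v : HeightOneSpectrum ℤ) {n : ℤ} (h : (natGenerator v : ℤ) ∣ n) :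
    n ∈ v.asIdeal := by
  obtain ⟨k, rfl⟩ := h
  exact v.asIdeal.mul_mem_right k (natGenerator_mem_asIdeal v)

/-- An integer lying in `v` is divisible by the prime below `v`. [folklore] -/
theorem dvd_of_intCast_mem_asIdeal (v : HeightOneSpectrum ℤ) {n : ℤ} (h : n ∈ v.asIdeal) :
    (natGenerator v : ℤ) ∣ n := by
  have h' : v.valuation ℚ (algebraMap ℤ ℚ n) < 1 := (v.valuation_lt_one_iff_mem n).mpr h
  rw [show algebraMap ℤ ℚ n = (n : ℚ) from eq_intCast _ n] at h'
  exact (Literature.NumberTheory.EllipticCurves.Rat.valuation_intCast_lt_one_iff v n).mp h'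

/-- At a bad place `c₄ = −4751` is a `v`-unit (`4751` is a prime other than `3, 5, 7, 59, 109`).
[cite: SilvermanAEC2009, VII.5 Prop. 5.1(b)] -/
theorem toy_valuation_c₄_eq_one {v : HeightOneSpectrum ℤ}
    (h : v.valuation ℚ (⟨1, 4, 0, 105, 0⟩ : WeierstrassCurve ℚ).Δ < 1) :
    v.valuation ℚ (⟨1, 4, 0, 105, 0⟩ : WeierstrassCurve ℚ).c₄ = 1 := by
  rw [toy_c₄, show (-4751 : ℚ) = ((-4751 : ℤ) : ℚ) by norm_num,
    Literature.NumberTheory.EllipticCurves.Rat.valuation_intCast_eq_one_iff, Int.dvd_neg]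
  rcases toy_natGenerator_mem h with hp | hp | hp | hp | hp <;> rw [hp] <;> norm_num

/-- `4751 ≠ 0` in the residue field at a bad place. [folklore] -/
theorem toy_not_mem_4751 {v : HeightOneSpectrum ℤ}
    (h : v.valuation ℚ (⟨1, 4, 0, 105, 0⟩ : WeierstrassCurve ℚ).Δ < 1) :
    (4751 : ℤ) ∉ v.asIdeal := by
  intro hmem
  have hd := dvd_of_intCast_mem_asIdeal v hmem
  rcases toy_natGenerator_mem h with hp | hp | hp | hp | hp <;> rw [hp] at hd <;> norm_num at hd

/-- **Multiplicative reduction at every bad place** (`v(c₄) = 1`, `v(Δ) < 1`; Silverman *AEC* VII.5.1(b)).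
[cite: SilvermanAEC2009, VII.5 Prop. 5.1(b)] -/
theorem toy_hasMultiplicativeReductionAt {v : HeightOneSpectrum ℤ}
    (h : v.valuation ℚ (⟨1, 4, 0, 105, 0⟩ : WeierstrassCurve ℚ).Δ < 1) :
    (⟨1, 4, 0, 105, 0⟩ : WeierstrassCurve ℚ).HasMultiplicativeReductionAt v :=
  haveI := toy_isElliptic
  hasMultiplicativeReductionAt_of_valuation_c₄_eq_one (toy_isIntegralAt v) (toy_valuation_c₄_eq_one h) h

/-! ### §3 The node-tangent quadratic `−4751 T² − 4751 T + 29714` at the bad places -/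

/-- The common core of the split/non-split analysis: at a bad place `v`, with `O = O_v`, `K = K_v`,
`EK = E₀ ⊗ K` (a minimal model, `c₄` being a unit), the node-tangent quadratic of the integral model of
`EK`, mapped to the residue field `κ`, is `−4751 T² − 4751 T + 29714`, and `E₀` has split multiplicative
reduction at `v` iff `EK` has, iff that quadratic splits over `κ`. [cite: SilvermanAEC2009, VII.5 Prop. 5.1(b)] -/
theorem toy_hasSplitMultiplicativeReductionAt_iff {v : HeightOneSpectrum ℤ}
    (h : v.valuation ℚ (⟨1, 4, 0, 105, 0⟩ : WeierstrassCurve ℚ).Δ < 1) :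
    (⟨1, 4, 0, 105, 0⟩ : WeierstrassCurve ℚ).HasSplitMultiplicativeReductionAt v ↔
      Splits (C (-4751 : IsLocalRing.ResidueField (v.adicCompletionIntegers ℚ)) * X ^ 2 +
        C (-4751 : IsLocalRing.ResidueField (v.adicCompletionIntegers ℚ)) * X +
        C (29714 : IsLocalRing.ResidueField (v.adicCompletionIntegers ℚ))) := by
  haveI := toy_isElliptic
  have hc₄ := toy_valuation_c₄_eq_one h
  have hW := toy_isIntegralAt v
  have hmult := toy_hasMultiplicativeReductionAt h
  set E : WeierstrassCurve ℚ := ⟨1, 4, 0, 105, 0⟩ with hEdef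
  set O := v.adicCompletionIntegers ℚ with hO
  set K := v.adicCompletion ℚ with hK
  set EK := E.baseChange K with hEK
  haveI hmin : EK.IsMinimal O :=
    isMinimalAt_of_lt_valuation_c₄ hW
      (by rw [hc₄, ← WithZero.exp_zero]; exact WithZero.exp_lt_exp.mpr (by norm_num))
  haveI : EK.IsElliptic := by rw [hEK, WeierstrassCurve.baseChange]; infer_instance
  obtain ⟨D, hD⟩ : ∃ D : VariableChange K, E.localMinimalModel v = D • EK := ⟨_, rfl⟩
  -- the integral model of `EK = E ⊗ K_v` has the integer coefficients of `E`
  have inj := IsFractionRing.injective O K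
  have hnat : ∀ n : ℕ, algebraMap O K (n : O) = (n : K) := fun n => map_natCast _ n
  have hc4 : (EK.integralModel O).c₄ = -((4751 : ℕ) : O) := inj <| by
    rw [integralModel_c₄_eq, map_neg, hnat, hEK, WeierstrassCurve.baseChange, map_c₄, toy_c₄]; norm_num
  have ha1 : (EK.integralModel O).a₁ = 1 := inj <| by
    rw [integralModel_a₁_eq, hEK, WeierstrassCurve.baseChange, map_a₁, map_one]; rfl
  have ha2 : (EK.integralModel O).a₂ = ((4 : ℕ) : O) := inj <| by
    rw [integralModel_a₂_eq, hnat, hEK, WeierstrassCurve.baseChange, map_a₂]; norm_num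
  have hb2 : (EK.integralModel O).b₂ = ((17 : ℕ) : O) := inj <| by
    rw [integralModel_b₂_eq, hnat, hEK, WeierstrassCurve.baseChange, map_b₂, toy_b₂]; norm_num
  have hb4 : (EK.integralModel O).b₄ = ((210 : ℕ) : O) := inj <| by
    rw [integralModel_b₄_eq, hnat, hEK, WeierstrassCurve.baseChange, map_b₄, toy_b₄]; norm_num
  have hb6 : (EK.integralModel O).b₆ = 0 := inj <| by
    rw [integralModel_b₆_eq, map_zero, hEK, WeierstrassCurve.baseChange, map_b₆, toy_b₆]; norm_num
  have hpoly : Polynomial.map (algebraMap O (IsLocalRing.ResidueField O)) (C (EK.integralModel O).c₄ * X ^ 2 +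
      C ((EK.integralModel O).a₁ * (EK.integralModel O).c₄) * X
      - C (54 * (EK.integralModel O).b₆ - 3 * (EK.integralModel O).b₂ * (EK.integralModel O).b₄ +
        (EK.integralModel O).a₂ * (EK.integralModel O).c₄)) =
      C (-4751 : IsLocalRing.ResidueField O) * X ^ 2 + C (-4751 : IsLocalRing.ResidueField O) * X +
        C (29714 : IsLocalRing.ResidueField O) := by
    rw [hc4, ha1, ha2, hb2, hb4, hb6]
    simp only [Polynomial.map_sub, Polynomial.map_add, Polynomial.map_mul, Polynomial.map_pow,
      Polynomial.map_X, map_mul, map_sub, map_add, map_neg, map_natCast, map_ofNat, map_zero, one_mul]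
    norm_num [sub_eq_add_neg, ← C_neg]
  unfold WeierstrassCurve.HasSplitMultiplicativeReductionAt
  rw [hasSplitMultiplicativeReduction_iff_of_isMinimal_of_eq_smul O hD EK.isUnit_Δ.ne_zero,
    hasSplitMultiplicativeReduction_iff]
  have hmEK : EK.HasMultiplicativeReduction O :=
    (hasMultiplicativeReduction_iff_of_isMinimal_of_eq_smul O hD EK.isUnit_Δ.ne_zero).mp hmult
  constructor
  · intro hS
    obtain ⟨_, hs⟩ := hS
    rw [hpoly] at hs
    exact hs
  · intro hs
    refine ⟨hmEK, ?_⟩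
    rw [hpoly]
    exact hs

/-- The map `ψ : ℤ → κ(O_v)` sends the value of the node-tangent quadratic at an integer `r` to its value
at `ψ r`. [folklore] -/
private theorem eval_quadratic_residue (v : HeightOneSpectrum ℤ) (r : ℤ) :
    eval (((IsLocalRing.residue (v.adicCompletionIntegers ℚ)).comp
        (algebraMap ℤ (v.adicCompletionIntegers ℚ))) r)
      (C (-4751 : IsLocalRing.ResidueField (v.adicCompletionIntegers ℚ)) * X ^ 2 +
        C (-4751 : IsLocalRing.ResidueField (v.adicCompletionIntegers ℚ)) * X +
        C (29714 : IsLocalRing.ResidueField (v.adicCompletionIntegers ℚ))) =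
      ((IsLocalRing.residue (v.adicCompletionIntegers ℚ)).comp
        (algebraMap ℤ (v.adicCompletionIntegers ℚ))) (-4751 * r ^ 2 - 4751 * r + 29714) := by
  simp only [eval_add, eval_mul, eval_C, eval_pow, eval_X]
  simp only [map_add, map_sub, map_mul, map_pow, map_neg, map_ofNat]
  ring

/-- **NON-SPLIT multiplicative reduction above `3, 5, 7`**: the quadratic `−4751 T² − 4751 T + 29714` has
no root modulo `3`, `5`, `7` (kernel-decided), hence none in `κ(O_v) = 𝔽_p` (a root lifts to an integer
`r` with `p ∣ −4751 r² − 4751 r + 29714`). [cite: Rohrlich1993Compositio, Prop. 2(ii)] -/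
theorem toy_not_split {v : HeightOneSpectrum ℤ}
    (h : v.valuation ℚ (⟨1, 4, 0, 105, 0⟩ : WeierstrassCurve ℚ).Δ < 1)
    (hp : natGenerator v = 3 ∨ natGenerator v = 5 ∨ natGenerator v = 7) :
    ¬ (⟨1, 4, 0, 105, 0⟩ : WeierstrassCurve ℚ).HasSplitMultiplicativeReductionAt v := by
  rw [toy_hasSplitMultiplicativeReductionAt_iff h]
  intro hsplit
  set O := v.adicCompletionIntegers ℚ with hO
  have h4751 : (-4751 : IsLocalRing.ResidueField O) ≠ 0 := by
    intro h0
    have : ((IsLocalRing.residue O).comp (algebraMap ℤ O)) 4751 = 0 := by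
      rw [RingHom.comp_apply, map_ofNat, map_ofNat]; exact neg_eq_zero.mp h0
    have hmem : (4751 : ℤ) ∈ v.asIdeal := by
      rw [← ker_residue_comp_algebraMap ℚ v]; exact this
    exact toy_not_mem_4751 h hmem
  have hdeg : (C (-4751 : IsLocalRing.ResidueField O) * X ^ 2 + C (-4751 : IsLocalRing.ResidueField O) * X
      + C (29714 : IsLocalRing.ResidueField O)).degree ≠ 0 := by
    rw [degree_quadratic h4751]; decide
  obtain ⟨t, ht⟩ := hsplit.exists_eval_eq_zero hdeg
  -- lift the root to an integer `r`
  obtain ⟨r, hr⟩ := residue_comp_algebraMap_surjective ℚ v t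
  have hι : ((IsLocalRing.residue O).comp (algebraMap ℤ O)) (-4751 * r ^ 2 - 4751 * r + 29714) = 0 := by
    rw [← eval_quadratic_residue v r, hr, ht]
  have hmem : (-4751 * r ^ 2 - 4751 * r + 29714 : ℤ) ∈ v.asIdeal := by
    rw [← ker_residue_comp_algebraMap ℚ v]; exact hι
  have hdvd := dvd_of_intCast_mem_asIdeal v hmem
  -- reduce modulo `p ∈ {3, 5, 7}`: no root there
  rcases hp with hp | hp | hp <;> rw [hp] at hdvd
  · have hz : ((-4751 * r ^ 2 - 4751 * r + 29714 : ℤ) : ZMod 3) = 0 :=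
      (ZMod.intCast_zmod_eq_zero_iff_dvd _ 3).mpr (by exact_mod_cast hdvd)
    push_cast at hz
    have key : ∀ x : ZMod 3, -4751 * x ^ 2 - 4751 * x + 29714 ≠ 0 := by decide
    exact key _ hz
  · have hz : ((-4751 * r ^ 2 - 4751 * r + 29714 : ℤ) : ZMod 5) = 0 :=
      (ZMod.intCast_zmod_eq_zero_iff_dvd _ 5).mpr (by exact_mod_cast hdvd)
    push_cast at hz
    have key : ∀ x : ZMod 5, -4751 * x ^ 2 - 4751 * x + 29714 ≠ 0 := by decide
    exact key _ hz
  · have hz : ((-4751 * r ^ 2 - 4751 * r + 29714 : ℤ) : ZMod 7) = 0 :=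
      (ZMod.intCast_zmod_eq_zero_iff_dvd _ 7).mpr (by exact_mod_cast hdvd)
    push_cast at hz
    have key : ∀ x : ZMod 7, -4751 * x ^ 2 - 4751 * x + 29714 ≠ 0 := by decide
    exact key _ hz

/-- **SPLIT multiplicative reduction above `59` and `109`**: `13` is a root of `−4751 T² − 4751 T + 29714`
modulo `59` (value `−834968 = −59·14152`) and `20` a root modulo `109` (value `−1965706 = −109·18034`),
so the quadratic splits over `κ(O_v)`. [cite: Rohrlich1993Compositio, Prop. 2(ii)] -/
theorem toy_split {v : HeightOneSpectrum ℤ}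
    (h : v.valuation ℚ (⟨1, 4, 0, 105, 0⟩ : WeierstrassCurve ℚ).Δ < 1)
    (hp : natGenerator v = 59 ∨ natGenerator v = 109) :
    (⟨1, 4, 0, 105, 0⟩ : WeierstrassCurve ℚ).HasSplitMultiplicativeReductionAt v := by
  rw [toy_hasSplitMultiplicativeReductionAt_iff h]
  set O := v.adicCompletionIntegers ℚ with hO
  have h4751 : (-4751 : IsLocalRing.ResidueField O) ≠ 0 := by
    intro h0
    have : ((IsLocalRing.residue O).comp (algebraMap ℤ O)) 4751 = 0 := by
      rw [RingHom.comp_apply, map_ofNat, map_ofNat]; exact neg_eq_zero.mp h0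
    have hmem : (4751 : ℤ) ∈ v.asIdeal := by
      rw [← ker_residue_comp_algebraMap ℚ v]; exact this
    exact toy_not_mem_4751 h hmem
  have hdeg : (C (-4751 : IsLocalRing.ResidueField O) * X ^ 2 + C (-4751 : IsLocalRing.ResidueField O) * X
      + C (29714 : IsLocalRing.ResidueField O)).degree = 2 := degree_quadratic h4751
  -- the root: `13` above `59`, `20` above `109`
  have hroot : ∃ r : ℤ, (natGenerator v : ℤ) ∣ -4751 * r ^ 2 - 4751 * r + 29714 := by
    rcases hp with hp | hp <;> rw [hp]
    · exact ⟨13, by norm_num⟩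
    · exact ⟨20, by norm_num⟩
  obtain ⟨r, hr⟩ := hroot
  refine Splits.of_degree_eq_two hdeg
    (x := ((IsLocalRing.residue O).comp (algebraMap ℤ O)) r) ?_
  rw [eval_quadratic_residue v r, ← RingHom.mem_ker, ker_residue_comp_algebraMap ℚ v]
  exact intCast_mem_asIdeal_of_dvd v hr

/-! ### §4 Local root numbers; semistability -/

/-- `w_v(E₀) = +1` at a good place. [cite: Rohrlich1993Compositio, Prop. 2(i)] -/
theorem toy_localRootNumberAt_of_good {v : HeightOneSpectrum ℤ}
    (h : v.valuation ℚ (⟨1, 4, 0, 105, 0⟩ : WeierstrassCurve ℚ).Δ = 1) :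
    (⟨1, 4, 0, 105, 0⟩ : WeierstrassCurve ℚ).localRootNumberAt v = 1 :=
  haveI := toy_isElliptic
  WeierstrassCurve.localRootNumberAt_of_hasGoodReductionAt
    (hasGoodReductionAt_of_valuation_Δ_eq_one_holds v _ (toy_isIntegralAt v) h)

/-- `w_v(E₀) = +1` above `3, 5, 7` (non-split multiplicative). [cite: Rohrlich1993Compositio, Prop. 2(ii)] -/
theorem toy_localRootNumberAt_of_not_split {v : HeightOneSpectrum ℤ}
    (h : v.valuation ℚ (⟨1, 4, 0, 105, 0⟩ : WeierstrassCurve ℚ).Δ < 1)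
    (hp : natGenerator v = 3 ∨ natGenerator v = 5 ∨ natGenerator v = 7) :
    (⟨1, 4, 0, 105, 0⟩ : WeierstrassCurve ℚ).localRootNumberAt v = 1 :=
  haveI := toy_isElliptic
  localRootNumberAt_of_hasMultiplicativeReductionAt_of_not_split (toy_hasMultiplicativeReductionAt h)
    (toy_not_split h hp)

/-- `w_v(E₀) = −1` above `59, 109` (split multiplicative). [cite: Rohrlich1993Compositio, Prop. 2(ii)] -/
theorem toy_localRootNumberAt_of_split {v : HeightOneSpectrum ℤ}
    (h : v.valuation ℚ (⟨1, 4, 0, 105, 0⟩ : WeierstrassCurve ℚ).Δ < 1)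
    (hp : natGenerator v = 59 ∨ natGenerator v = 109) :
    (⟨1, 4, 0, 105, 0⟩ : WeierstrassCurve ℚ).localRootNumberAt v = -1 :=
  haveI := toy_isElliptic
  localRootNumberAt_of_hasSplitMultiplicativeReductionAt (toy_split h hp)

/-- **`E₀` is semistable** (good or multiplicative reduction everywhere). [cite: SilvermanAEC2009, VII.5 Prop. 5.1] -/
theorem toy_isSemistable : (⟨1, 4, 0, 105, 0⟩ : WeierstrassCurve ℚ).IsSemistable ℤ := by
  haveI := toy_isElliptic
  intro v
  have hint := toy_isIntegralAt v
  rcases (WeierstrassCurve.valuation_Δ_le_one_of_isIntegralAt hint).eq_or_lt with h | h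
  · exact WeierstrassCurve.isSemistableAt_of_valuation_Δ_eq_one hint h
  · exact WeierstrassCurve.isSemistableAt_of_valuation_c₄_eq_one hint (toy_valuation_c₄_eq_one h)

/-- No place of additive reduction. [cite: SilvermanAEC2009, VII.5 Prop. 5.1] -/
theorem toy_not_hasAdditiveReductionAt (v : HeightOneSpectrum ℤ) :
    ¬ (⟨1, 4, 0, 105, 0⟩ : WeierstrassCurve ℚ).HasAdditiveReductionAt v :=
  haveI := toy_isElliptic
  (WeierstrassCurve.isSemistableAt_iff_not_hasAdditiveReductionAt v _).mp (toy_isSemistable v)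

/-- **The conductor of `E₀` is squarefree.** [cite: Silverman1994, IV.10.2] -/
theorem toy_squarefree_conductorNorm :
    Squarefree ((⟨1, 4, 0, 105, 0⟩ : WeierstrassCurve ℚ).conductorNorm ℤ) :=
  haveI := toy_isElliptic
  (WeierstrassCurve.isSemistable_iff_squarefree_conductorNorm _).mp toy_isSemistable

end Summit.BirchSwinnertonDyer.Rank2

end
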